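import Summits.AtomisticToContinuum.BoseEinsteinCondensation.Theorems.BoxCountShadowTruncation
import HarnessLib

/-!
# BoxCountShadowCoercivity — continuation of BoxCountShadowTruncation: DLT_h ⟸ COERC_h ∧ UB (§12)

Continuation of `BoxCountShadowTruncation` (same namespace; v7 of the CountShadow line).  The truncated density
law of large numbers DLT_h is split into two ENERGY statements:

* **COERC_h** `GroundStateHorizonCellCoercivity η` — *cell coercivity of the energy for low-energy states at the
  horizon scale*: below a density cap, eventually in `N`, every Bose-symmetric `N`-body function whose closed
  Dirichlet energy is within the factor `1 + ε` of the leading term `4πaρN` has truncated count variance `≤ s`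
  in every horizon window.  Class: the Lieb–Yngvason cell method at the horizon scale `ℓ_h ≍ Mρ^{-1/2-η}`
  (Neumann cells `⊂` Dirichlet box: `LSSY2005_cellDecomposition_holds`,
  `sum_neumannGroundStateEnergy_mul_le_setLIntegral_cellSet`; Thm 2.4 in EACH horizon cell:
  `LSSY2005_lowerBound_neumann_holds`, valid since `ℓ_h/a ≫ Y^{-6/17}`; the cap `N_B ≥ 8λ` by superadditivity
  `LSSY2005_superadditivity_holds` — linear, not quadratic, in `N_B`, which is exactly why the energy controls
  `min((N_B/λ − 1)², 1)` and not `(N_B/λ − 1)²` [LSSY2005, (2.52)–(2.53) and the convexity discussion after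
  (2.53)]; the convex minorant `x² ≥ (2x − 1) + min((x − 1)², 1)` on `[0, 8]`, `4x ≥ 2x` beyond).
* **UB** — the leading-order Dirichlet ground-state energy upper bound at fixed density, eventually in `N`:
  this is the tree THEOREM `eventually_groundStateEnergy_le_dyson` ([LSSY2005, Thm. 2.2 (2.14)–(2.15)], proved in
  `DiluteBoseGasUpperBoundLocalization`), so it is discharged here, not assumed.

Proved: `densityLLNTrunc_of_coercivity : COERC_h → DLT_h` (UB discharged by the tree theorem; the density cap is
shrunk until the Dyson correction `C(ρa³)^{1/3}` is `≤ ε`), the doors `horizonRingShare_of_coercivity : COERC_h → RSH_h`,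
`horizonCellInsertion_of_coercivity : DISP_h → COERC_h → INS_h`,
`horizonCellCountAffinity_of_coercivity : DISP_h → COERC_h → MARG_h`, and the kernel
`bec_of_coercivity₀ : UGS → LOC_h → COERC_h → DISP_h → CSUF_h → SUF_h → BoseEinsteinCondensation`.
No instances, no notation, no sorry.
-/

open MeasureTheory Filter Set
open scoped ENNReal NNReal BigOperators

namespace Summit.AtomisticToContinuum.BoseEinsteinCondensation.Theorems.BoxCountShadow

open Literature.MathematicalPhysics.QuantumManyBody.BoseGas
open Summit.AtomisticToContinuum.BoseEinsteinCondensation.Theorems.BoxLatticeFSum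
open Summit.AtomisticToContinuum.BoseEinsteinCondensation.Theorems.BoxLabelAffinity
open Summit.AtomisticToContinuum.BoseEinsteinCondensation.Theorems.BoxHorizonAffinity

variable {n : ℕ}

/-! ### §12  Cell coercivity for low-energy states and the discharge of the upper bound -/

/-- **COERC_h(η)** (door input beneath DLT_h · TAG ENERGY-CLASS (Lieb–Yngvason cell method at the horizon scale) ·
TRUE-type · leaf ATTACKABLE·M — every ingredient is a tree theorem: `LSSY2005_lowerBound_neumann_holds` (Thm 2.4,
all `N, L`), `LSSY2005_cellDecomposition_holds` / `sum_neumannGroundStateEnergy_mul_le_setLIntegral_cellSet` (2.52),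
`LSSY2005_superadditivity_holds` (2.53)) `GroundStateHorizonCellCoercivity η` — **cell coercivity of the energy for
low-energy states**: for `a > 0`, every target `s > 0` and horizon constant `M > 0` there are `ε > 0` and a density cap
below which, eventually in `N`, EVERY measurable Bose-symmetric `Φ : (ℝ³)^N → ℝ` with closed Dirichlet energy
`q̄[Φ] ≤ 4πaρ(1 + ε)N` in the box of side `(N/ρ)^{1/3}` (so `‖Φ‖₂ = 1`, `Φ` in the form domain) has truncated count
variance `Σ_B K⁻³ E_{Φ²} min((N_B/λ − 1)², 1) ≤ s` for every `K` of the horizon window (`λ = N/K³ ≍ M³ρ^{-1/2-3η}`).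
Mechanism: Neumann-decompose into the `K³` horizon cells and drop cross-cell interactions; in each cell with
`x = N_B/λ ≤ 8`, Thm 2.4 gives `E₀^N(N_B, ℓ_h) ≥ 4πaρλ·x²(1 − CY_B^{1/17})` (`ℓ_h/a ≍ Mρ^{-1/2-η}/a ≫ C'Y_B^{-6/17}`
unless `x ≤ ρ^{2}`, where `E ≥ 0` costs `≤ x²`); for `x ≥ 8` superadditivity gives `≥ ⌊x/8⌋·64(1 − CY^{1/17}) ≥ 2x`
units; since `Σ_B K⁻³ x_B = 1` and `x² = (2x − 1) + (x − 1)²`, `q̄[Φ] ≥ 4πaρN[(1 − C'Y^{1/17})(1 + Σ_B K⁻³ E min((x_B −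
1)², 1)) − ρ⁴]`, and the hypothesis `q̄[Φ] ≤ 4πaρN(1 + ε)` forces the truncated variance `≤ 2ε + o_ρ(1) ≤ s`.
Why it might fail: (i) the statement is about the CLOSED form `closedEnergy` (an `inf` of `liminf`s over `C¹`
Dirichlet trial states) — the cell bound is proved on the `C¹` core and must be carried to `Φ` by `L²`-continuity of
the bounded functional `countVarianceTrunc` (`IsGroundState.exists_tendstoL2`-type approximation); (ii) the horizon
tiling `subCell (L/K)` versus the cell method's `cellSet`/`cellCorner` indexing needs a dictionary; (iii) the linear
(superadditive) regime is why only the TRUNCATED square is controlled — the untruncated DL_h is NOT claimed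
[LSSY2005, after (2.53): superadditivity, not convexity, is available]. [cite: LSSY2005, Thm. 2.4 (2.35), (2.52)–(2.53); LiebYngvason1998] -/
@[conjecture] def GroundStateHorizonCellCoercivity (η : ℝ≥0) : Prop :=
  ∀ v : ℝ → ℝ≥0∞, IsRepulsiveFiniteRange v → 0 < scatteringLength v →
    ∀ s : ℝ, 0 < s → ∀ M : ℝ, 0 < M → ∃ ε : ℝ, 0 < ε ∧ ∃ ρ₀ : ℝ, 0 < ρ₀ ∧ ∀ ρ : ℝ, 0 < ρ → ρ < ρ₀ →
      ∀ᶠ n : ℕ in atTop, ∀ Φ : Config (n + 1) → ℝ, Measurable Φ →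
        (∀ (σ : Equiv.Perm (Fin (n + 1))) (X : Config (n + 1)), Φ (X ∘ σ) = Φ X) →
        closedEnergy v (sideLength ρ (n + 1)) (fun X => (Φ X : ℂ)) ≤
          ENNReal.ofReal (4 * Real.pi * ρ * (scatteringLength v).toReal * (1 + ε) * (((n + 1 : ℕ) : ℝ))) →
        ∀ K : ℕ, 0 < K → InWindow (M * ρ ^ (-(η : ℝ))) ρ (sideLength ρ (n + 1)) K →
          countVarianceTrunc (sideLength ρ (n + 1)) K Φ ≤ ENNReal.ofReal s

/-- The Dyson correction is below `ε` under the density cap `ρ < (ε/C)³/a³`: `C(ρa³)^{1/3} ≤ ε`. [folklore] -/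
theorem dysonCorrection_le {C ε a ρ : ℝ} (hC : 0 < C) (hε : 0 < ε) (ha : 0 < a) (hρ : 0 ≤ ρ)
    (hρlt : ρ ≤ (ε / C) ^ 3 / a ^ 3) : C * (ρ * a ^ 3) ^ ((1 : ℝ) / 3) ≤ ε := by
  have h1 : ρ * a ^ 3 ≤ (ε / C) ^ 3 := by
    rwa [le_div_iff₀ (by positivity)] at hρlt
  have h2 : (ρ * a ^ 3) ^ ((1 : ℝ) / 3) ≤ ((ε / C) ^ 3) ^ ((1 : ℝ) / 3) :=
    Real.rpow_le_rpow (by positivity) h1 (by norm_num)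
  have h3 : ((ε / C) ^ 3) ^ ((1 : ℝ) / 3) = ε / C := by
    rw [show ((1 : ℝ) / 3) = ((3 : ℕ) : ℝ)⁻¹ by norm_num,
      Real.pow_rpow_inv_natCast (by positivity) (by norm_num)]
  calc C * (ρ * a ^ 3) ^ ((1 : ℝ) / 3) ≤ C * (ε / C) := by
        rw [← h3]; exact mul_le_mul_of_nonneg_left h2 hC.le
    _ = ε := mul_div_cancel₀ ε hC.ne'

/-- **COERC_h ⟹ DLT_h** — the leading-order upper bound is DISCHARGED by the tree theorem
`eventually_groundStateEnergy_le_dyson` [LSSY2005, Thm. 2.2]: below the cap `min(ρ₀^{COERC}, ρ₀^{UB}, (ε/C)³/a³)` the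
ground state has `q̄[Ψ₀] = E₀^D(N, L_N) ≤ 4πaρ(1 + C(ρa³)^{1/3})N ≤ 4πaρ(1 + ε)N` eventually, so cell coercivity
applies to `Ψ₀ = groundState`. [cite: LSSY2005, Thm. 2.2 (2.14)–(2.15)] -/
theorem densityLLNTrunc_of_coercivity (η : ℝ≥0) (hco : GroundStateHorizonCellCoercivity η) :
    GroundStateHorizonDensityLLNTrunc η := by
  intro v hv ha s hs M hM
  obtain ⟨ε, hε, ρ₁, hρ₁, h⟩ := hco v hv ha s hs M hM
  obtain ⟨R₀, hR₀⟩ := hv.2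
  have hfin : scatteringLength v ≠ ⊤ := IsRepulsiveFiniteRange.scatteringLength_ne_top hv
  obtain ⟨C, ρ₂, hC, hρ₂, hub⟩ := eventually_groundStateEnergy_le_dyson hR₀ hv.1 hfin ha
  set a : ℝ := (scatteringLength v).toReal with hadef
  have ha0 : 0 < a := ENNReal.toReal_pos ha.ne' hfin
  set ρ₃ : ℝ := (ε / C) ^ 3 / a ^ 3 with hρ₃def
  have hρ₃ : 0 < ρ₃ := by positivity
  refine ⟨min ρ₁ (min ρ₂ ρ₃), lt_min hρ₁ (lt_min hρ₂ hρ₃), fun ρ hρ hρlt => ?_⟩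
  have hρ1 : ρ < ρ₁ := lt_of_lt_of_le hρlt (min_le_left _ _)
  have hρ2 : ρ < ρ₂ := lt_of_lt_of_le hρlt ((min_le_right _ _).trans (min_le_left _ _))
  have hρ3 : ρ < ρ₃ := lt_of_lt_of_le hρlt ((min_le_right _ _).trans (min_le_right _ _))
  have hY : C * (ρ * a ^ 3) ^ ((1 : ℝ) / 3) ≤ ε := dysonCorrection_le hC hε ha0 hρ.le hρ3.le
  have hub' : ∀ᶠ n : ℕ in atTop, groundStateEnergy v (n + 1) (sideLength ρ (n + 1)) ≤
      ENNReal.ofReal (4 * Real.pi * ρ * a * (1 + C * (ρ * a ^ 3) ^ ((1 : ℝ) / 3)) * (((n + 1 : ℕ) : ℝ))) :=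
    (tendsto_add_atTop_nat 1).eventually (hub ρ hρ hρ2)
  filter_upwards [h ρ hρ hρ1, hub'] with n hn hubn hex K hK hKw
  have hgs := isGroundState_groundState hex
  refine hn (groundState v (n + 1) (sideLength ρ (n + 1))) (measurable_groundState v (n + 1) _)
    (fun σ X => groundState_comp_perm v _ σ X) ?_ K hK hKw
  rw [hgs.closedEnergy_eq]
  refine hubn.trans (ENNReal.ofReal_le_ofReal ?_)
  have h4 : 0 ≤ 4 * Real.pi * ρ * a := by positivity
  have hN : (0 : ℝ) ≤ ((n + 1 : ℕ) : ℝ) := by positivity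
  have hin : 1 + C * (ρ * a ^ 3) ^ ((1 : ℝ) / 3) ≤ 1 + ε := by linarith
  exact mul_le_mul_of_nonneg_right (mul_le_mul_of_nonneg_left hin h4) hN

/-- **COERC_h ⟹ RSH_h** (through DLT_h). [folklore] -/
theorem horizonRingShare_of_coercivity (η : ℝ≥0) (hco : GroundStateHorizonCellCoercivity η) :
    GroundStateHorizonRingShare η :=
  horizonRingShare_of_densityLLNTrunc η (densityLLNTrunc_of_coercivity η hco)

/-- **DISP_h ∧ COERC_h ⟹ INS_h**: the residual's energy half is discharged down to the LY cell class. [folklore] -/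
theorem horizonCellInsertion_of_coercivity (η : ℝ≥0) (hdisp : GroundStateHorizonDisplacement η)
    (hco : GroundStateHorizonCellCoercivity η) : GroundStateHorizonCellInsertion η :=
  horizonCellInsertion_of_displacement η hdisp (horizonRingShare_of_coercivity η hco)

/-- **DISP_h ∧ COERC_h ⟹ MARG_h** (the residual of record). [folklore] -/
theorem horizonCellCountAffinity_of_coercivity (η : ℝ≥0) (hdisp : GroundStateHorizonDisplacement η)
    (hco : GroundStateHorizonCellCoercivity η) : GroundStateHorizonCellCountAffinity η :=
  horizonCellCountAffinity_of_insertion η (horizonCellInsertion_of_coercivity η hdisp hco)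

/-- The kernel through the displacement door with the ring share discharged by CELL COERCIVITY (and the tree's
Dyson upper bound): UGS → LOC_h(η) → COERC_h(η) → DISP_h(η) → CSUF_h(η) → SUF_h(η) → `BoseEinsteinCondensation`.
[folklore] -/
theorem bec_of_coercivity₀ (η : ℝ≥0) (hU : BoxGroundStateUniqueness)
    (hloc : GroundStateHorizonCondensation η) (hco : GroundStateHorizonCellCoercivity η)
    (hdisp : GroundStateHorizonDisplacement η) (hcsuf : GroundStateHorizonCellCountSufficiency η)
    (hsuf : GroundStateHorizonCountSufficiency η) : _root_.BoseEinsteinCondensation :=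
  bec_of_displacement₂ η hU hloc (densityLLNTrunc_of_coercivity η hco) hdisp hcsuf hsuf

end Summit.AtomisticToContinuum.BoseEinsteinCondensation.Theorems.BoxCountShadow
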